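import Summits.AnomalousDissipation.AnomalousDissipation.Theorems.MomentParityPathField
import Literature.Analysis.FluidPDE.LerayHopfRestartTorus
import Literature.Analysis.FluidPDE.NSHopfWeakConvergence
import Literature.Analysis.FluidPDE.WeakSolution

/-!
# Crux `EnsembleRealization` (stmt-AnomalousDissipation-0215) — line `augmented-lift`,
# stub `stub_restart` (step B-a), tools: the weak formulation of a translate

Supports stmt-AnomalousDissipation-0215 (registered tools stub `stub_restartTranslateTools`, used by
`stub_restart` of line `augmented-lift` in `StirringSphereEnsembleRealizationStubRestart.lean`).
Nothing here closes an item.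

The Literature lemmas `Torus.IsLerayHopfOn.weakIdentity_translate` and
`Torus.IsLerayHopfOn.isWeakNSSolutionForcedOn_translate` (Robinson–Rodrigo–Sadowski 2016, §3.1,
cut-off argument) are keyed on a Leray–Hopf hypothesis but use only its fields `weak` and
`memLp`. The restart step of the augmented lift starts from a weak solution on `[0, ∞)` which is
NOT known to be Leray–Hopf from time `0` (only from almost every time), so the two lemmas are
re-proved here VERBATIM under the field-level hypotheses
`IsWeakNSSolutionForcedOn (T + s) ν g u₀ u` and `MemLp (u τ) 2` on `[s, s + T]`
(proofs adapted from `Literature/Analysis/FluidPDE/LerayHopfTranslateTorus.lean`, unchanged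
otherwise).
-/

noncomputable section

set_option linter.dupNamespace false

open MeasureTheory TopologicalSpace Set Function Filter Topology InnerProductSpace UnitAddTorus
open scoped RealInnerProductSpace ENNReal NNReal ContDiff

namespace Summit.AnomalousDissipation.AnomalousDissipation.Theorems.EnsembleRealization

open Literature.Analysis.FunctionSpaces Literature.Analysis.FunctionSpaces.Torus
open Literature.Analysis.FluidPDE Literature.Analysis.FluidPDE.Torus

variable {d : Type*} [Fintype d] [DecidableEq d]
variable {ν : ℝ} {g : UnitAddTorus d → EuclideanSpace ℝ d}
  {u : ℝ → UnitAddTorus d → EuclideanSpace ℝ d} {u₀ : UnitAddTorus d → EuclideanSpace ℝ d}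

/-- **The weak identity of the translate, from the weak formulation alone.** Let `u` be a forced
weak solution on `T^d × [0, T + s)` (`T, s > 0`) driven by the steady smooth force `g`, with
`L²` slices on `[s, s + T]` and `‖u(τ) - u(s)‖_{L²} → 0` as `τ → s⁺`. Then for every smooth
divergence-free test field `ψ` on `[0, T)`,
`∫₀ᵀ ∫ (⟪u(t+s), ∂ₜψ⟫ + ⟪u(t+s), (u(t+s)·∇)ψ⟫ + ν⟪u(t+s), Δψ⟫ + ⟪g, ψ⟫) + ∫⟪u(s), ψ(0)⟫ = 0`
(adapted from `Torus.IsLerayHopfOn.weakIdentity_translate`; Robinson–Rodrigo–Sadowski 2016,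
§3.1 p. 58). -/
theorem weakIdentity_translate_of_weak {s T : ℝ}
    (hweak : IsWeakNSSolutionForcedOn (T + s) ν (fun _ => g) u₀ u) (hg : Literature.Analysis.FunctionSpaces.Torus.IsSmooth g)
    (hs : 0 < s) (hT : 0 < T)
    (hmem : ∀ τ ∈ Icc s (s + T), MemLp (u τ) 2 volume)
    (h0 : Tendsto (fun τ => eLpNorm (u τ - u s) 2 volume) (𝓝[>] s) (𝓝 0))
    {ψ : ℝ → UnitAddTorus d → EuclideanSpace ℝ d} (hψ : Literature.Analysis.FunctionSpaces.Torus.IsSpaceTimeTest T ψ)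
    (hdiv : Literature.Analysis.FunctionSpaces.Torus.IsDivFreeTest ψ) :
    (∫ t in Ioo 0 T, ∫ x, (⟪u (t + s) x, Literature.Analysis.FunctionSpaces.Torus.timeDeriv ψ t x⟫ +
        ⟪u (t + s) x, Literature.Analysis.FunctionSpaces.Torus.convect (u (t + s)) (ψ t) x⟫ +
        ν * ⟪u (t + s) x, Literature.Analysis.FunctionSpaces.Torus.laplacian (ψ t) x⟫ + ⟪g x, ψ t x⟫)) +
      ∫ x, ⟪u s x, ψ 0 x⟫ = 0 := by
  have hTs : 0 < T + s := by linarith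
  -- the shifted test field on `[0, T + s)`
  set ψs : ℝ → UnitAddTorus d → EuclideanSpace ℝ d := fun τ => ψ (τ + -s) with hψs_def
  have hψs : Literature.Analysis.FunctionSpaces.Torus.IsSpaceTimeTest (T + s) ψs := by
    have h := hψ.comp_add_right (-s)
    rwa [sub_neg_eq_add] at h
  have hdivs : Literature.Analysis.FunctionSpaces.Torus.IsDivFreeTest ψs := fun τ => hdiv (τ + -s)
  -- the functionals of `u` against `ψs` on `(0, T + s)`
  set P : ℝ → ℝ := fun τ => ∫ x, ⟪u τ x, ψs τ x⟫ with hP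
  set Φ₀ : ℝ → ℝ := fun τ => ∫ x, (⟪u τ x, Literature.Analysis.FunctionSpaces.Torus.timeDeriv ψs τ x⟫ +
    ⟪u τ x, Literature.Analysis.FunctionSpaces.Torus.convect (u τ) (ψs τ) x⟫ +
    ν * ⟪u τ x, Literature.Analysis.FunctionSpaces.Torus.laplacian (ψs τ) x⟫) with hΦ₀
  set G : ℝ → ℝ := fun τ => ∫ x, ⟪g x, ψs τ x⟫ with hG
  set Φ : ℝ → ℝ := fun τ => ∫ x, (⟪u τ x, Literature.Analysis.FunctionSpaces.Torus.timeDeriv ψs τ x⟫ +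
    ⟪u τ x, Literature.Analysis.FunctionSpaces.Torus.convect (u τ) (ψs τ) x⟫ +
    ν * ⟪u τ x, Literature.Analysis.FunctionSpaces.Torus.laplacian (ψs τ) x⟫ + ⟪g x, ψs τ x⟫) with hΦ
  set L : ℝ := ∫ x, ⟪u s x, ψ 0 x⟫ with hL
  obtain ⟨hm, h2, -, -⟩ := id hweak
  -- bounds for the shifted test field on `[0, T + s]`
  obtain ⟨Kq, hKq⟩ := hψs.exists_bound (isCompact_Icc (a := 0) (b := T + s))
  -- integrability of `P`, `Φ₀`, `G`, `Φ` on `(0, T + s)`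
  have hPi : IntegrableOn P (Ioo 0 (T + s)) :=
    integrableOn_integral_inner_of_lintegral hm h2 hψs.continuous_uncurry
      (fun τ hτ x => hKq τ (Ioo_subset_Icc_self hτ) x)
  have hΦ₀i : IntegrableOn Φ₀ (Ioo 0 (T + s)) := integrableOn_nsWeakFunctional hm h2 hψs
  have hGi : IntegrableOn G (Ioo 0 (T + s)) :=
    integrableOn_integral_inner_of_lintegral (U := fun _ => g) (aestronglyMeasurable_stLift_const hg _)
      (lintegral_enorm_sq_const_lt_top hg _) hψs.continuous_uncurry
      (fun τ hτ x => hKq τ (Ioo_subset_Icc_self hτ) x)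
  have hΦeq : ∀ᵐ τ ∂(volume.restrict (Ioo 0 (T + s))), Φ τ = Φ₀ τ + G τ := by
    filter_upwards [ae_memLp_two_slice_of_lintegral hm h2] with τ hτ
    have hi : Integrable (u τ) volume := hτ.integrable one_le_two
    have i1 : Integrable (fun x => ⟪u τ x, Literature.Analysis.FunctionSpaces.Torus.timeDeriv ψs τ x⟫ +
        ⟪u τ x, Literature.Analysis.FunctionSpaces.Torus.convect (u τ) (ψs τ) x⟫ +
        ν * ⟪u τ x, Literature.Analysis.FunctionSpaces.Torus.laplacian (ψs τ) x⟫) volume :=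
      ((Literature.Analysis.FunctionSpaces.Torus.integrable_inner_of_continuous hi
        (hψs.timeDeriv.isSmooth_slice τ).continuous).add
        (Literature.Analysis.FunctionSpaces.Torus.integrable_inner_convect_slice hψs hτ)).add
        ((Literature.Analysis.FunctionSpaces.Torus.integrable_inner_of_continuous hi
          (hψs.isSmooth_slice τ).laplacian.continuous).const_mul ν)
    have i2 : Integrable (fun x => ⟪g x, ψs τ x⟫) volume :=
      Literature.Analysis.FunctionSpaces.Torus.integrable_inner_of_continuous hg.integrable (hψs.isSmooth_slice τ).continuous
    simp only [hΦ, hΦ₀, hG]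
    rw [← integral_add i1 i2]
  have hΦi : IntegrableOn Φ (Ioo 0 (T + s)) := (hΦ₀i.add hGi).congr_fun_ae (by
    filter_upwards [hΦeq] with τ hτ using hτ.symm)
  -- the cut-offs `η k` with derivatives `ρ k`, at scale `δ k = T / (6 (k + 1))`
  set δ : ℕ → ℝ := fun k => T / (6 * ((k : ℝ) + 1)) with hδ
  have hδ0 : ∀ k, 0 < δ k := fun k => by positivity
  have hδT : ∀ k, 3 * δ k ≤ T := fun k => by
    have hk : (0 : ℝ) ≤ k := Nat.cast_nonneg k
    have h1 : δ k ≤ T / 6 := by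
      show T / (6 * ((k : ℝ) + 1)) ≤ T / 6
      exact div_le_div_of_nonneg_left hT.le (by norm_num) (by nlinarith)
    linarith
  have hδlim : Tendsto δ atTop (𝓝 0) := by
    have h1 : Tendsto (fun k : ℕ => (k : ℝ) + 1) atTop atTop :=
      tendsto_atTop_add_const_right _ 1 tendsto_natCast_atTop_atTop
    have h3 : Tendsto (fun k : ℕ => 6 * ((k : ℝ) + 1)) atTop atTop :=
      h1.const_mul_atTop (by norm_num)
    exact tendsto_const_nhds.div_atTop h3
  obtain hcut : ∀ k, ∃ η ρ : ℝ → ℝ, ContDiff ℝ (⊤ : ℕ∞) η ∧ Continuous ρ ∧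
      (∀ σ, HasDerivAt η (ρ σ) σ) ∧ (∀ σ, σ ≤ δ k → η σ = 0) ∧ (∀ σ, 3 * δ k ≤ σ → η σ = 1) ∧
      (∀ σ, η σ ∈ Icc (0 : ℝ) 1) ∧ (∀ σ, 0 ≤ ρ σ) ∧ (∀ σ, σ ∉ Ioo (δ k) (3 * δ k) → ρ σ = 0) ∧
      ∫ σ, ρ σ = 1 := fun k => exists_smooth_time_cutoff (hδ0 k)
  choose η ρ hηs hρc hηρ hη0 hη1 hη01 hρ0 hρsupp hρ1 using hcut
  have hηabs : ∀ k σ, |η k σ| ≤ 1 := fun k σ => by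
    rw [abs_le]
    exact ⟨by linarith [(hη01 k σ).1], (hη01 k σ).2⟩
  have hρC : ∀ k, ∃ C, 0 ≤ C ∧ ∀ σ, |ρ k σ| ≤ C := fun k =>
    exists_abs_le_of_eq_zero_off_Ioo (hρc k) (hρsupp k)
  -- the shifted cut-offs `τ ↦ η k (τ - s)`
  have hηks : ∀ k, ContDiff ℝ ∞ (fun τ => η k (τ + -s)) := fun k =>
    (hηs k).comp (contDiff_id.add contDiff_const)
  have hderiv : ∀ k τ, deriv (fun τ => η k (τ + -s)) τ = ρ k (τ + -s) := fun k τ =>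
    (HasDerivAt.comp_add_const τ (-s) (hηρ k (τ + -s))).deriv
  have hηk0 : ∀ k, η k (0 + -s) = 0 := fun k => hη0 k _ (by linarith [hδ0 k])
  -- Step 1: the tested identity for each `k`
  have hAB : ∀ k, (∫ τ in Ioo 0 (T + s), ρ k (τ + -s) * P τ) +
      ∫ τ in Ioo 0 (T + s), η k (τ + -s) * Φ τ = 0 := by
    intro k
    obtain ⟨C, -, hC⟩ := hρC k
    have key := IsWeakNSSolutionForcedOn.test_smul_time hweak hg.integrable hψs hdivs (hηks k)
    simp only [hderiv k, hηk0 k, zero_mul, add_zero] at key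
    have iρP : IntegrableOn (fun τ => ρ k (τ + -s) * P τ) (Ioo 0 (T + s)) :=
      hPi.bdd_mul ((hρc k).comp (continuous_id.add continuous_const)).aestronglyMeasurable
        (ae_of_all _ fun τ => by rw [Real.norm_eq_abs]; exact hC _)
    have iηΦ : IntegrableOn (fun τ => η k (τ + -s) * Φ τ) (Ioo 0 (T + s)) :=
      hΦi.bdd_mul ((hηs k).continuous.comp (continuous_id.add continuous_const)).aestronglyMeasurable
        (ae_of_all _ fun τ => by rw [Real.norm_eq_abs]; exact hηabs k _)
    rw [← integral_add iρP iηΦ]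
    exact key
  -- Step 2a: `∫ η_k(τ - s) Φ(τ) dτ → ∫_{(s, T+s)} Φ`
  have hA : Tendsto (fun k => ∫ τ in Ioo 0 (T + s), η k (τ + -s) * Φ τ) atTop
      (𝓝 (∫ τ in Ioo s (T + s), Φ τ)) := by
    have hset : Ioo 0 (T + s) ∩ Ioi s = Ioo s (T + s) := by
      ext τ
      simp only [mem_Ioo, mem_inter_iff, mem_Ioi]
      constructor
      · rintro ⟨⟨-, h2⟩, h1⟩; exact ⟨h1, h2⟩
      · rintro ⟨h1, h2⟩; exact ⟨⟨hs.trans h1, h2⟩, h1⟩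
    have hlim : ∫ τ in Ioo s (T + s), Φ τ = ∫ τ in Ioo 0 (T + s), (Ioi s).indicator Φ τ := by
      rw [setIntegral_indicator measurableSet_Ioi, hset]
    rw [hlim]
    refine tendsto_integral_of_dominated_convergence (fun τ => ‖Φ τ‖)
      (fun k => (((hηs k).continuous.comp (continuous_id.add continuous_const)).aestronglyMeasurable.mul
        hΦi.aestronglyMeasurable)) hΦi.norm (fun k => ae_of_all _ fun τ => ?_) (ae_of_all _ fun τ => ?_)
    · rw [norm_mul, Real.norm_eq_abs]
      exact mul_le_of_le_one_left (norm_nonneg _) (hηabs k _)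
    · by_cases hτ : τ ∈ Ioi s
      · rw [indicator_of_mem hτ]
        have hτs : 0 < τ + -s := by linarith [mem_Ioi.1 hτ]
        have h3 : Tendsto (fun k => 3 * δ k) atTop (𝓝 0) := by
          simpa using hδlim.const_mul 3
        have hev : ∀ᶠ k in atTop, 3 * δ k < τ + -s := (tendsto_order.1 h3).2 _ hτs
        refine (tendsto_const_nhds (x := Φ τ)).congr' ?_
        filter_upwards [hev] with k hk
        show Φ τ = η k (τ + -s) * Φ τ
        rw [hη1 k _ hk.le, one_mul]
      · rw [indicator_of_notMem hτ]
        have hτs : τ + -s ≤ 0 := by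
          have := not_lt.1 (mt mem_Ioi.2 hτ)
          linarith
        refine (tendsto_const_nhds (x := (0 : ℝ))).congr' (Eventually.of_forall fun k => ?_)
        show (0 : ℝ) = η k (τ + -s) * Φ τ
        rw [hη0 k _ (hτs.trans (hδ0 k).le), zero_mul]
  -- Step 2b: `∫ ρ_k(τ - s) P(τ) dτ → ⟨u(s), ψ(0)⟩`
  have hB : Tendsto (fun k => ∫ τ in Ioo 0 (T + s), ρ k (τ + -s) * P τ) atTop (𝓝 L) := by
    -- the pairing of the translate with `ψ`
    set U : ℝ → ℝ := fun t => ∫ x, ⟪u (t + s) x, ψ t x⟫ with hU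
    have hcv : ∀ k, ∫ τ in Ioo 0 (T + s), ρ k (τ + -s) * P τ = ∫ t in Ioo 0 T, ρ k t * U t := by
      intro k
      have h1 := setIntegral_Ioo_comp_add_right (fun τ => ρ k (τ + -s) * P τ) (-s) T s
      rw [neg_add_cancel] at h1
      rw [← h1]
      have hpt : ∀ t, ρ k (t + s + -s) * P (t + s) = ρ k t * U t := by
        intro t
        simp only [hP, hU, hψs_def, add_neg_cancel_right]
      simp only [hpt]
      refine setIntegral_eq_of_subset_of_forall_sdiff_eq_zero measurableSet_Ioo
        (Ioo_subset_Ioo_left (by linarith)) fun t ht => ?_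
      have hts : t ≤ 0 := by
        by_contra hc
        exact ht.2 ⟨not_le.1 hc, ht.1.2⟩
      rw [hρsupp k t (fun h' => by linarith [h'.1, hδ0 k]), zero_mul]
    simp_rw [hcv]
    -- integrability of `U` on `(0, T)`
    obtain ⟨K, hK⟩ := hψ.exists_bound (isCompact_Icc (a := 0) (b := T))
    have hUi : IntegrableOn U (Ioo 0 T) :=
      integrableOn_integral_inner_of_lintegral (aestronglyMeasurable_stLift_translate hs.le le_rfl hm)
        ((lintegral_translate_le hs.le le_rfl).trans_lt h2) hψ.continuous_uncurry
        (fun t ht x => hK t (Ioo_subset_Icc_self ht) x)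
    -- the right limit of `U` at `0⁺`
    have hUlim : Tendsto U (𝓝[>] 0) (𝓝 L) := tendsto_integral_inner_translate_nhdsGT hψ hT hmem h0
    have hlim : ∀ ε > 0, ∃ τ₀ > 0, ∀ᵐ t ∂(volume.restrict (Ioo 0 τ₀)), |U t - L| ≤ ε := by
      intro ε hε
      have hev : ∀ᶠ t in 𝓝[>] (0 : ℝ), |U t - L| ≤ ε := by
        have h1 := (Metric.tendsto_nhds.1 hUlim) ε hε
        filter_upwards [h1] with t ht
        rw [Real.dist_eq] at ht
        exact ht.le
      obtain ⟨τ₀, hτ₀, hsub⟩ := mem_nhdsGT_iff_exists_Ioo_subset.1 hev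
      refine ⟨τ₀, hτ₀, (ae_restrict_iff' measurableSet_Ioo).2 (ae_of_all _ fun t ht => hsub ht)⟩
    exact tendsto_setIntegral_mul_of_ae_tendsto hUi hlim hδlim hδ0 hδT hρc hρ0 hρsupp hρ1
  -- Step 3: the limit identity on `(s, T + s)`
  have hsum : L + ∫ τ in Ioo s (T + s), Φ τ = 0 :=
    tendsto_nhds_unique (hB.add hA) (by simpa only [hAB] using tendsto_const_nhds)
  -- Step 4: change variables `τ = t + s`
  have hcv : ∫ τ in Ioo s (T + s), Φ τ = ∫ t in Ioo 0 T, ∫ x,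
      (⟪u (t + s) x, Literature.Analysis.FunctionSpaces.Torus.timeDeriv ψ t x⟫ +
        ⟪u (t + s) x, Literature.Analysis.FunctionSpaces.Torus.convect (u (t + s)) (ψ t) x⟫ +
        ν * ⟪u (t + s) x, Literature.Analysis.FunctionSpaces.Torus.laplacian (ψ t) x⟫ + ⟪g x, ψ t x⟫) := by
    have h1 := setIntegral_Ioo_comp_add_right Φ 0 T s
    rw [zero_add] at h1
    rw [← h1]
    refine setIntegral_congr_fun measurableSet_Ioo fun t _ => ?_
    have hslice : ψs (t + s) = ψ t := by
      funext y
      simp [hψs_def]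
    have hder : ∀ y, Literature.Analysis.FunctionSpaces.Torus.timeDeriv ψs (t + s) y = Literature.Analysis.FunctionSpaces.Torus.timeDeriv ψ t y := by
      intro y
      rw [hψs_def, timeDeriv_comp_add_right ψ (-s) (t + s) y, add_neg_cancel_right]
    simp only [hΦ, hder]
    rw [hslice]
  rw [hcv] at hsum
  linarith

/-- **The translate is a forced weak solution from its initial slice, from the weak formulation
alone** (adapted from `Torus.IsLerayHopfOn.isWeakNSSolutionForcedOn_translate`). -/
theorem isWeakNSSolutionForcedOn_translate_of_weak {s T : ℝ}
    (hweak : IsWeakNSSolutionForcedOn (T + s) ν (fun _ => g) u₀ u) (hg : Literature.Analysis.FunctionSpaces.Torus.IsSmooth g)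
    (hs : 0 < s) (hT : 0 < T)
    (hmem : ∀ τ ∈ Icc s (s + T), MemLp (u τ) 2 volume)
    (h0 : Tendsto (fun τ => eLpNorm (u τ - u s) 2 volume) (𝓝[>] s) (𝓝 0)) :
    IsWeakNSSolutionForcedOn T ν (fun _ => g) (u s) (fun t => u (t + s)) := by
  obtain ⟨hm, h2, hdiv, -⟩ := id hweak
  have hsub : Ioo (0 + s) (T + s) ⊆ Ioo 0 (T + s) := fun t ht =>
    ⟨by linarith [ht.1], ht.2⟩
  refine ⟨aestronglyMeasurable_stLift_translate hs.le le_rfl hm,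
    (lintegral_translate_le hs.le le_rfl).trans_lt h2,
    ae_restrict_Ioo_comp_add_right s (ae_mono (Measure.restrict_mono hsub le_rfl) hdiv),
    fun ψ hψ hψdiv => weakIdentity_translate_of_weak hweak hg hs hT hmem h0 hψ hψdiv⟩

/-! ### Registered tools stub -/

/-- **Tools stub (registered as `stub_restartTranslateTools` on stmt-AnomalousDissipation-0215).**
The translate `t ↦ u (t + s)` of a forced weak solution on `[0, T + s)` with `L²` slices on
`[s, s + T]` and strong right-continuity at `s` is a forced weak solution on `[0, T)` from `u s`
(= `isWeakNSSolutionForcedOn_translate_of_weak` on `T³`). -/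
theorem stub_restartTranslateTools (ν' s T : ℝ) (g' : UnitAddTorus (Fin 3) → EuclideanSpace ℝ (Fin 3))
    (w : ℝ → UnitAddTorus (Fin 3) → EuclideanSpace ℝ (Fin 3)) (w₀ : UnitAddTorus (Fin 3) → EuclideanSpace ℝ (Fin 3))
    (hweak : IsWeakNSSolutionForcedOn (T + s) ν' (fun _ => g') w₀ w) (hg : IsSmooth g') (hs : 0 < s) (hT : 0 < T)
    (hmem : ∀ τ ∈ Icc s (s + T), MemLp (w τ) 2 volume)
    (h0 : Tendsto (fun τ => eLpNorm (w τ - w s) 2 volume) (𝓝[>] s) (𝓝 0)) :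
    IsWeakNSSolutionForcedOn T ν' (fun _ => g') (w s) (fun t => w (t + s)) :=
  isWeakNSSolutionForcedOn_translate_of_weak hweak hg hs hT hmem h0

end Summit.AnomalousDissipation.AnomalousDissipation.Theorems.EnsembleRealization
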